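import Summits.BirchSwinnertonDyer.Rank1Residual.X11b.Three.UnramifiedClassNodeLiftInputs
import Summits.BirchSwinnertonDyer.Rank1Residual.X11b.Three.GoodReductionSubgroupCuspPresentation
import Literature.NumberTheory.DiophantineGeometry.TateAlgorithmOrdDiscriminant
import Literature.NumberTheory.DiophantineGeometry.LocalReductionProofs
import Mathlib.FieldTheory.Finite.Basic
import HarnessLib

/-!
# X11b at `p = 3` (team N8/O2), S15 additive places, (C1) road: the inertia-invariant Frobenius
# lift at a place of ADDITIVE reduction (Milne ADT I.3.8, Step 1 at a cusp: `𝔾_a` and Artin–Schreier)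

HONEST FRAMING (cell `b2b-bsdres`, run/shared/lean/b2b/bsd-rank1-residual/, verbatim in every
file): the goal of the cell is to DELETE the COMBINATION-SHAPED residual classes of the
Birch–Swinnerton-Dyer formula for ALL analytic-rank `≤ 1` elliptic curves over `ℚ` — "full BSD
formula for every rank `≤ 1` curve in class `C`" assembled STRICTLY from published theorems — so
that the rank-`≤ 1` remainder becomes exactly the CONSTRUCTION-SHAPED classes, which are TYPED
(missing-input `Prop`s), NOT attempted. This is not "finishing BSD". Team N8/O2 = `x11b3`, seat
`b2b-bsdres-x11b3-p8` (GEN 3), LEAD DEAL #7 R7-35 items (2)+(3): the (C1) END FORM at ADDITIVE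
places in the `K̄_v` / unramified-class framework; x11b3-p4 is the PROVIDER of record at additive
places (parts 12–15: the cusp map with formula, its ring-hom compatibility, the cusp presentation
over a perfect field), consumed here by name. LABEL OF RECORD: flag-discharge hygiene for `JET@p|N`
(harvest E66 (D)) — NOT count-moving; nothing is booked; `O2` OPEN. THEOREMS ONLY: no definition,
no named fact, no `sorry`.

## What

Step 1 of Milne's proof of *ADT* I.3.8 (the tree's `GoodReductionLangLift.exists_lift_sub_mem_kernel`
at good reduction; the cell's `exists_lift_sub_mem_kernel_of_hasMultiplicativeReductionAt` at a
node) at a place `v` of ADDITIVE reduction, for points of `E₀`, in the `K̄_v`-currency of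
`SelmerInertia` (`K_v`, `K̄_v`, spectral valuation `w` with valuation ring `𝒪_w` and
algebraically closed residue field `k_{𝒪_w}`, the prime `𝔐` of `\bar 𝓞_v` with inertia group
`I_𝔐`, `M = W.localMinimalIntegralModel v`, `V = M ⊗ K̄_v`, `ι : 𝓞_v → 𝒪_w`, `W₀ = M.map ι`):

* §1 `exists_pow_sub_self_eq` — "Lang's theorem" for `𝔾_a` over an algebraically closed field
  = Artin–Schreier: `β^q - β = a` is solvable (`q ≥ 2`).
* §2 `exists_map_residue_eq_singularModel_cusp_of_hasAdditiveReductionAt` — the `K̄_v`-level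
  packaging of p4's field lemma `exists_eq_singularModel_cusp_of_perfectField` (part 14): at an
  additive place (`π ∣ Δ(M)`, `π ∣ c₄(M)`, tree `hasAdditiveReductionAt_iff_mem`) the reduction of
  `W₀` modulo `𝔪_w` is a PRESENTED CUSP `singularModel x₀ y₀ α α` over `k_{𝒪_w}`. No second
  presentation lemma (R7-35): this is a 10-line call of p4's.
* §3 **`exists_lift_sub_mem_kernel_of_hasAdditiveReductionAt`** — for `φ ∈ Γ_{K_v}` inducing the
  `q_v`-power map on residues and `m ∈ V(K̄_v)` with nonsingular reduction on `W₀`, there is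
  `b ∈ V(K̄_v)` fixed by `I_𝔐` with `m - (φ b - b) ∈ V₁(K̄_v)`: p4's cusp map with formula
  `r = cuspFun ∘ (reduction) : E₀(K̄_v) →+ k_{𝒪_w}` (part 12, kernel `V₁`); the residue map `φ̄` of
  the isometry `φ` is `Frob_{q_v}` and fixes `x₀, y₀, α` (tree `singularModel.apply_eq_of_map_eq`),
  so `r(φ P) = (r P)^{q_v}` on integral points (p4's `cuspFun_map_some`); §1 for `r(m)`;
  `singularModel.cuspHom_surjective`; the cell's `exists_lift_forall_inertia`; and
  `r(m - (φb - b)) = a - (β^q - β) = 0`.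

This is the hypothesis `hlift` of `UnramifiedClassCoboundary.exists_eq_map_sub_of_cocycle_of_lift`
for `E₀`-valued crossed homomorphisms at additive `v`; the sequel `UnramifiedClassCusp` assembles
the vanishing theorem and the END-FORM corollary.

HONEST CONSEQUENCE (LEAD R7-16a (3) / R7-35): NOT a discharge of `JET@p|N`. At an additive place
the component group `Φ_v` has order `c_v ≤ 4` (incl. `c_v = 3` for Kodaira IV, IV*) and ALL of that
content sits in "the Kolyvagin cocycle is `B ⊆ E₀`-valued" (binder `hGZ31`, [GZ86, III (3.1)],
x11b3-p1's (iv)); no Tamagawa hypothesis appears here BECAUSE the receptacle is `E₀`. The labelled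
residual R7′ (minimality over unramified layers) belongs to the finite-layer road, not to this one.

References (locators only; no cited FACT): [cite: MilneADT2006, Ch. I Prop. 3.8 (proof)]
[cite: SilvermanAEC2009, Prop. III.2.5(b), Prop. VII.2.1, Prop. VII.5.1(c)]
[cite: SerreLocalFields1979, X §1 (additive Hilbert 90 / Artin–Schreier)]; cell files p4 parts
12/14 (`GoodReductionSubgroupCuspFrobenius`, `GoodReductionSubgroupCuspPresentation`), p8
`UnramifiedClassNodeLiftInputs` (p256222).

## Design

`noncomputable section`; no definitions; no local notation; heartbeats raised for §3. Namespace
`Summit.BirchSwinnertonDyer.Rank1Residual.X11b.Three.UnramifiedNode`. Axioms: `propext`,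
`Classical.choice`, `Quot.sound`.
-/

noncomputable section

open scoped Classical NNReal
open NumberField IsDedekindDomain Field Polynomial ValuativeRel

universe u

namespace Summit.BirchSwinnertonDyer.Rank1Residual.X11b.Three.UnramifiedNode

open WeierstrassCurve Literature.NumberTheory.EllipticCurves
  Literature.NumberTheory.EllipticCurves.FormalGroupChart
  Literature.NumberTheory.GaloisRepresentations
  Literature.NumberTheory.GaloisRepresentations.IsNonarchimedeanLocalField IsDedekindDomain.HeightOneSpectrum
  Summit.BirchSwinnertonDyer.Rank1Residual.X11b.Three.JetchevKummer

/-! ### §1 "Lang" for `𝔾_a`: Artin–Schreier over an algebraically closed field -/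

section ArtinSchreier

variable {k : Type*} [Field k] [IsAlgClosed k]

/-- **"Lang's theorem" for `𝔾_a` over an algebraically closed field (Artin–Schreier)**: for
`q ≥ 2` every `a` is `β^q - β` (a root of `X^q - X - a`, a polynomial of degree `q`). Silverman,
*AEC*, Ex. 3.5 / Serre, *Local Fields*, X §1 (`Ẽ_ns(k) ≅ k⁺` at a cusp). [folklore] -/
theorem exists_pow_sub_self_eq {q : ℕ} (hq : 2 ≤ q) (a : k) : ∃ β : k, β ^ q - β = a := by
  set p : k[X] := X ^ q - X - C a with hp
  have hnat : p.natDegree = q := by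
    rw [hp, natDegree_sub_C, FiniteField.X_pow_card_sub_X_natDegree_eq k (by omega : 1 < q)]
  have hp0 : p ≠ 0 := fun h ↦ by rw [h, natDegree_zero] at hnat; omega
  have hdeg : p.degree ≠ 0 := by
    rw [degree_eq_natDegree hp0, hnat]; exact_mod_cast (by omega : q ≠ 0)
  obtain ⟨β, hβ⟩ := IsAlgClosed.exists_root p hdeg
  refine ⟨β, ?_⟩
  rw [hp, IsRoot.def] at hβ
  simp only [eval_sub, eval_pow, eval_X, eval_C] at hβ
  exact sub_eq_zero.mp hβ

end ArtinSchreier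

/-! ### §2 The presented cusp over `k_{𝒪_w}` at a place of additive reduction (p4's part 14, packaged) -/

section Model

variable {K : Type u} [Field K] [NumberField K] {v : HeightOneSpectrum (𝓞 K)}
  {w : Valuation (AlgebraicClosure (v.adicCompletion K)) ℝ≥0}
  (hw : ∀ x, (w x : ℝ) = spectralNorm (v.adicCompletion K) (AlgebraicClosure (v.adicCompletion K)) x)
  {ι : v.adicCompletionIntegers K →+* w.integer}
  (hι : ∀ a, ((ι a : w.integer) : AlgebraicClosure (v.adicCompletion K)) =
    algebraMap (v.adicCompletion K) (AlgebraicClosure (v.adicCompletion K)) (a : v.adicCompletion K))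

include hw hι in
/-- **The reduction of the minimal model at a place of additive reduction is a PRESENTED cusp over
`k_{𝒪_w} ≅ k̄_v`**: `(M.map ι) mod 𝔪_w = singularModel x₀ y₀ α α`. The `K̄_v`-packaging of
x11b3-p4's field lemma `exists_eq_singularModel_cusp_of_perfectField` (part 14): `π ∣ Δ(M)`,
`π ∣ c₄(M)` (tree `hasAdditiveReductionAt_iff_mem`), pushed along the local homomorphism `ι`, give
`Δ̄ = c̄₄ = 0` for `W₀ = M.map ι`, and `k_{𝒪_w}` is algebraically closed, hence perfect.
Silverman, *AEC*, VII.5.1(c), III.2.5(b). [cite: SilvermanAEC2009, Prop. VII.5.1(c)] -/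
theorem exists_map_residue_eq_singularModel_cusp_of_hasAdditiveReductionAt
    {W : WeierstrassCurve K} (hadd : W.HasAdditiveReductionAt v) :
    ∃ x₀ y₀ α : IsLocalRing.ResidueField w.integer,
      ((W.localMinimalIntegralModel v).map ι).map (IsLocalRing.residue w.integer) =
        singularModel x₀ y₀ α α := by
  haveI hιloc := isLocalHom_of_coe_eq hw hι
  haveI : IsAlgClosed (IsLocalRing.ResidueField w.integer) := isAlgClosed_residueField_integer w
  haveI : PerfectField (IsLocalRing.ResidueField w.integer) := IsAlgClosed.perfectField _
  obtain ⟨hΔ, hc₄⟩ := (hasAdditiveReductionAt_iff_mem v W).mp hadd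
  refine exists_eq_singularModel_cusp_of_perfectField _ ?_ ?_
  · rw [map_Δ, map_Δ, IsLocalRing.residue_eq_zero_iff, IsLocalRing.mem_maximalIdeal,
      mem_nonunits_iff]
    exact fun h ↦ (IsLocalRing.mem_maximalIdeal _ |>.mp hΔ) (isUnit_of_map_unit ι _ h)
  · rw [map_c₄, map_c₄, IsLocalRing.residue_eq_zero_iff, IsLocalRing.mem_maximalIdeal,
      mem_nonunits_iff]
    exact fun h ↦ (IsLocalRing.mem_maximalIdeal _ |>.mp hc₄) (isUnit_of_map_unit ι _ h)

/-! ### §3 Step 1 of Milne's proof at a cusp: the inertia-invariant Frobenius lift on `E₀` -/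

include hw hι in
set_option maxHeartbeats 1600000 in
/-- **Milne ADT I.3.8, Step 1 at a place of ADDITIVE reduction: `𝔾_a` and Artin–Schreier replace
Lang's theorem.** Let `E/K` have additive reduction at `v`, `M = W.localMinimalIntegralModel v`,
`V = M ⊗ K̄_v`, `W₀ = M.map ι` its `𝒪_w`-model, `𝔐` the prime of `\bar 𝓞_v` above `𝓂_v` with
inertia group `I_𝔐 ≤ Γ_{K_v}`, and `φ ∈ Γ_{K_v}` inducing the `q_v`-power map on residues. Then for
every `m ∈ V(K̄_v)` with NONSINGULAR reduction on `W₀` there is `b ∈ V(K̄_v)` FIXED BY `I_𝔐` with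
`m - (φ b - b) ∈ V₁(K̄_v)`. Proof: `W̃₀` is a presented cusp over `k_{𝒪_w} ≅ k̄_v` (§2, p4's part
14); p4's cusp map with formula `r = cuspFun ∘ (reduction) : E₀(K̄_v) →+ k_{𝒪_w}` (part 12) has
kernel `V₁`; the residue map `φ̄` of the isometry `φ` is the `q_v`-power map and fixes the cusp
`(x₀, y₀)` and its tangent slope `α` (tree `singularModel.apply_eq_of_map_eq`), so on integral
points `r(φ P) = φ̄(r P) = (r P)^{q_v}` (p4's `cuspFun_map_some`); Artin–Schreier
`β^{q_v} - β = r(m)` (§1); the point of `Ẽ_ns` with value `β` (`singularModel.cuspHom_surjective`)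
lifts `I_𝔐`-invariantly (`exists_lift_forall_inertia`); and `r(m - (φb - b)) = r(m) - (β^{q_v} - β) = 0`.
The hypothesis `hlift` of `exists_eq_map_sub_of_cocycle_of_lift` for `E₀`-valued crossed
homomorphisms at additive `v`. NOT a discharge of `JET@p|N` (component-group content in `hGZ31`).
[cite: MilneADT2006, Ch. I Prop. 3.8 (proof)]
[cite: SilvermanAEC2009, Prop. III.2.5(b), Prop. VII.2.1, Prop. VII.5.1(c)]
[cite: SerreLocalFields1979, X §1] -/
theorem exists_lift_sub_mem_kernel_of_hasAdditiveReductionAt (W : WeierstrassCurve K) [W.IsElliptic]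
    (hadd : W.HasAdditiveReductionAt v)
    {𝔐 : Ideal v.localAbsIntegers} (h𝔐 : 𝔐 ∈ v.localPrimesAbove)
    [hV : (((W.localMinimalIntegralModel v).map
        (algebraMap (v.adicCompletionIntegers K) (v.adicCompletion K))).baseChange
        (AlgebraicClosure (v.adicCompletion K))).IsIntegral w.integer]
    {φ : absoluteGaloisGroup (v.adicCompletion K)}
    (hφq : ∀ z : AlgebraicClosure (v.adicCompletion K), w z ≤ 1 →
      w (absoluteGaloisGroup.toAlgEquiv (v.adicCompletion K) φ z -
        z ^ Nat.card (IsLocalRing.ResidueField (v.adicCompletionIntegers K))) < 1)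
    (m : (((W.localMinimalIntegralModel v).map
        (algebraMap (v.adicCompletionIntegers K) (v.adicCompletion K))).baseChange
        (AlgebraicClosure (v.adicCompletion K))).toAffine.Point)
    (hm : ((W.localMinimalIntegralModel v).map ι).HasNonsingularReduction
      (Affine.Point.congrEquiv (baseChange_map_eq_baseChange_map hι (W.localMinimalIntegralModel v)) m)) :
    ∃ b : (((W.localMinimalIntegralModel v).map
        (algebraMap (v.adicCompletionIntegers K) (v.adicCompletion K))).baseChange
        (AlgebraicClosure (v.adicCompletion K))).toAffine.Point,
      (∀ τ ∈ 𝔐.inertia (absoluteGaloisGroup (v.adicCompletion K)),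
        WeierstrassCurve.Affine.Point.map (W' := (W.localMinimalIntegralModel v).map (algebraMap (v.adicCompletionIntegers K) (v.adicCompletion K))) ((absoluteGaloisGroup.toAlgEquiv (v.adicCompletion K) τ :
          AlgebraicClosure (v.adicCompletion K) ≃ₐ[v.adicCompletion K] AlgebraicClosure (v.adicCompletion K)) :
          AlgebraicClosure (v.adicCompletion K) →ₐ[v.adicCompletion K] AlgebraicClosure (v.adicCompletion K)) b = b) ∧
      m - (WeierstrassCurve.Affine.Point.map (W' := (W.localMinimalIntegralModel v).map (algebraMap (v.adicCompletionIntegers K) (v.adicCompletion K))) ((absoluteGaloisGroup.toAlgEquiv (v.adicCompletion K) φ :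
          AlgebraicClosure (v.adicCompletion K) ≃ₐ[v.adicCompletion K] AlgebraicClosure (v.adicCompletion K)) :
          AlgebraicClosure (v.adicCompletion K) →ₐ[v.adicCompletion K] AlgebraicClosure (v.adicCompletion K)) b - b)
        ∈ FormalGroupChart.kernel w (((W.localMinimalIntegralModel v).map
            (algebraMap (v.adicCompletionIntegers K) (v.adicCompletion K))).baseChange
            (AlgebraicClosure (v.adicCompletion K))) := by
  have hvw : w.Integers w.integer := Valuation.integer.integers w
  have hφw : ∀ z, w (absoluteGaloisGroup.toAlgEquiv (v.adicCompletion K) φ z) = w z :=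
    fun z ↦ spectralValuation_smul hw φ z
  have hq2 := two_le_natCard_residueField (K := K) (v := v)
  haveI : IsAlgClosed (IsLocalRing.ResidueField w.integer) := isAlgClosed_residueField_integer w
  -- the curve `V` is elliptic
  haveI hVell : ((((W.localMinimalIntegralModel v).map (algebraMap (v.adicCompletionIntegers K) (v.adicCompletion K))).baseChange (AlgebraicClosure (v.adicCompletion K)))).IsElliptic := by
    haveI := W.isElliptic_localMinimalModel v
    have hM : (W.localMinimalIntegralModel v).map (algebraMap (v.adicCompletionIntegers K) (v.adicCompletion K)) = W.localMinimalModel v :=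
      baseChange_integralModel_eq (v.adicCompletionIntegers K) (W.localMinimalModel v)
    rw [hM]
    infer_instance
  have hX : ((W.localMinimalIntegralModel v).map (algebraMap (v.adicCompletionIntegers K) (v.adicCompletion K))).baseChange
      (AlgebraicClosure (v.adicCompletion K)) = ((W.localMinimalIntegralModel v).map ι).baseChange (AlgebraicClosure (v.adicCompletion K)) :=
    baseChange_map_eq_baseChange_map hι (W.localMinimalIntegralModel v)
  -- kernel membership is reduction to `O` on `W₀`
  have hker : ∀ P : (((W.localMinimalIntegralModel v).map (algebraMap (v.adicCompletionIntegers K) (v.adicCompletion K))).baseChange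
      (AlgebraicClosure (v.adicCompletion K))).toAffine.Point,
      ((W.localMinimalIntegralModel v).map ι).ReducesToZero (Affine.Point.congrEquiv hX P) ↔ P ∈ FormalGroupChart.kernel w
        (((W.localMinimalIntegralModel v).map (algebraMap (v.adicCompletionIntegers K) (v.adicCompletion K))).baseChange
          (AlgebraicClosure (v.adicCompletion K))) := by
    intro P
    rcases P with _ | ⟨x, y, h⟩
    · rw [← Affine.Point.zero_def, map_zero]
      exact iff_of_true WeierstrassCurve.reducesToZero_zero
        (fun he ↦ (Affine.Point.some_ne_zero _ he.symm).elim)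
    · rw [Affine.Point.congrEquiv_some, WeierstrassCurve.reducesToZero_some_iff,
        not_mem_range_iff hvw, FormalGroupChart.some_mem_kernel_iff]
  -- the presented cusp `W̃₀ = singularModel x₀ y₀ α α` and p4's cusp map `r`
  obtain ⟨x₀, y₀, α, hW⟩ :=
    exists_map_residue_eq_singularModel_cusp_of_hasAdditiveReductionAt hw hι hadd
  obtain ⟨r, hr0, hr⟩ := exists_addMonoidHom_of_map_eq_singularModel_cusp
    ((W.localMinimalIntegralModel v).map ι) hvw hW
  -- the residue map `φ̄` of the isometry `φ` (as in the tree's `NodeReductionGaloisProofs`)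
  let σR : w.integer →+* w.integer :=
    { toFun := fun a ↦ ⟨absoluteGaloisGroup.toAlgEquiv (v.adicCompletion K) φ a, by
        rw [Valuation.mem_integer_iff, hφw]; exact a.2⟩
      map_one' := Subtype.ext (by simp)
      map_mul' := fun a b ↦ Subtype.ext (by simp)
      map_zero' := Subtype.ext (by simp)
      map_add' := fun a b ↦ Subtype.ext (by simp) }
  have hσR : ∀ a : w.integer, (σR a : AlgebraicClosure (v.adicCompletion K)) =
      absoluteGaloisGroup.toAlgEquiv (v.adicCompletion K) φ a := fun _ ↦ rfl
  haveI : IsLocalHom σR := by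
    refine ⟨fun a ha ↦ ?_⟩
    rw [hvw.isUnit_iff_valuation_eq_one] at ha ⊢
    rw [← ha]
    exact (hφw a).symm
  let σk : IsLocalRing.ResidueField w.integer →+* IsLocalRing.ResidueField w.integer :=
    IsLocalRing.ResidueField.map σR
  have hσk : ∀ a : w.integer, σk (IsLocalRing.residue w.integer a) =
      IsLocalRing.residue w.integer (σR a) := fun a ↦ IsLocalRing.ResidueField.map_residue σR a
  -- `φ̄` is the `q`-power map
  have hσkq : ∀ x : IsLocalRing.ResidueField w.integer,
      σk x = x ^ Nat.card (IsLocalRing.ResidueField (v.adicCompletionIntegers K)) := by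
    intro x
    obtain ⟨z, rfl⟩ := IsLocalRing.residue_surjective x
    have hz : w (z : AlgebraicClosure (v.adicCompletion K)) ≤ 1 := z.2
    have hzq : w ((z : AlgebraicClosure (v.adicCompletion K)) ^
        Nat.card (IsLocalRing.ResidueField (v.adicCompletionIntegers K))) ≤ 1 := by
      rw [map_pow]; exact pow_le_one₀ zero_le hz
    rw [hσk]
    refine (WeierstrassCurve.residue_eq_of_val_sub_lt_one (w := w) hzq (σR z).2 (hφq _ hz)).trans ?_
    rw [← map_pow]
    exact congrArg _ (Subtype.ext (by simp))
  -- `φ̄` fixes the reduced equation, hence the cusp and its tangent slope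
  have hWσ : ((W.localMinimalIntegralModel v).map ι).map σR = (W.localMinimalIntegralModel v).map ι := by
    rw [WeierstrassCurve.map_map]
    congr 1
    ext c
    change absoluteGaloisGroup.toAlgEquiv (v.adicCompletion K) φ ((ι c : w.integer) : AlgebraicClosure (v.adicCompletion K)) = ι c
    rw [hι]
    exact AlgEquiv.commutes _ _
  have hWk : (singularModel x₀ y₀ α α).map σk = singularModel x₀ y₀ α α := by
    rw [← hW, WeierstrassCurve.map_map]
    change ((W.localMinimalIntegralModel v).map ι).map
      ((IsLocalRing.ResidueField.map σR).comp (IsLocalRing.residue w.integer)) = _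
    rw [IsLocalRing.ResidueField.map_comp_residue, ← WeierstrassCurve.map_map, hWσ]
  obtain ⟨hx₀, hy₀, hslopes⟩ := singularModel.apply_eq_of_map_eq hWk
  have hα : σk α = α := by rcases hslopes with ⟨h, -⟩ | ⟨h, -⟩ <;> exact h
  -- `m` in `E₀`, its value `a = r(m)`; trivial case `m ∈ V₁`
  have hmE : Affine.Point.congrEquiv hX m ∈ ((W.localMinimalIntegralModel v).map ι).nonsingularReductionSubgroup hvw := hm
  by_cases hrm : r ⟨_, hmE⟩ = 0
  · refine ⟨0, fun τ _ ↦ by rw [map_zero], ?_⟩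
    rw [map_zero, sub_self, sub_zero]
    exact (hker m).mp ((hr0 ⟨_, hmE⟩).mp hrm)
  -- Artin–Schreier: `β^q - β = a`
  obtain ⟨β, hβ⟩ := exists_pow_sub_self_eq hq2 (r ⟨_, hmE⟩)
  -- the point of `Ẽ_ns` with value `β`; it is not `Õ` since `a ≠ 0`
  obtain ⟨Q, hQ⟩ := singularModel.cuspHom_surjective (x₀ := x₀) (y₀ := y₀) (α := α) β
  rcases Q with _ | ⟨αQ, βQ, hnsQ⟩
  · exfalso
    rw [← Affine.Point.zero_def, map_zero] at hQ
    apply hrm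
    rw [← hβ, ← hQ, zero_pow (by omega), sub_zero]
  rw [singularModel.cuspHom_apply] at hQ
  -- the lift of `Q = (αQ, βQ)` to an `I_𝔐`-invariant `𝒪_w`-point `(a₁, b₁)` of `W₀`
  have hnsW : (((W.localMinimalIntegralModel v).map ι).map (IsLocalRing.residue w.integer)).toAffine.Nonsingular αQ βQ := by
    rw [hW]; exact hnsQ
  obtain ⟨a₁, b₁, hab, ha₁, hb₁, ha₁I, hb₁I⟩ :=
    exists_lift_forall_inertia hw hι h𝔐 (W.localMinimalIntegralModel v) hnsW
  have hL : (((W.localMinimalIntegralModel v).map (algebraMap (v.adicCompletionIntegers K) (v.adicCompletion K))).baseChange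
      (AlgebraicClosure (v.adicCompletion K))).toAffine.Nonsingular
      (a₁ : AlgebraicClosure (v.adicCompletion K)) (b₁ : AlgebraicClosure (v.adicCompletion K)) := by
    rw [← Affine.equation_iff_nonsingular, hX]
    exact (map_equation_iff hvw.hom_inj).mpr hab
  have hL' : (((W.localMinimalIntegralModel v).map ι).baseChange (AlgebraicClosure (v.adicCompletion K))).toAffine.Nonsingular
      (algebraMap w.integer (AlgebraicClosure (v.adicCompletion K)) a₁)
      (algebraMap w.integer (AlgebraicClosure (v.adicCompletion K)) b₁) := by
    have h := hL; rw [hX] at h; exact h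
  have hns_res : (singularModel x₀ y₀ α α).toAffine.Nonsingular (IsLocalRing.residue w.integer a₁)
      (IsLocalRing.residue w.integer b₁) := by
    rw [ha₁, hb₁]; exact hnsQ
  have hbE' : ∀ h', ((W.localMinimalIntegralModel v).map ι).HasNonsingularReduction
      (.some (algebraMap w.integer (AlgebraicClosure (v.adicCompletion K)) a₁)
        (algebraMap w.integer (AlgebraicClosure (v.adicCompletion K)) b₁) h') := fun h' ↦
    (hasNonsingularReduction_some_algebraMap_iff hvw.hom_inj h').mpr (by rw [hW]; exact hns_res)
  have hcongr : Affine.Point.congrEquiv hX (.some _ _ hL) = .some _ _ hL' := by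
    rw [Affine.Point.congrEquiv_some]; rfl
  have hbE : ((W.localMinimalIntegralModel v).map ι).HasNonsingularReduction (Affine.Point.congrEquiv hX (.some _ _ hL)) := by
    rw [hcongr]; exact hbE' _
  have hbEm : Affine.Point.congrEquiv hX (.some _ _ hL) ∈
      ((W.localMinimalIntegralModel v).map ι).nonsingularReductionSubgroup hvw := hbE
  -- `r(b) = β`
  have hrb : r ⟨_, hbEm⟩ = β := by
    have h1 : (⟨Affine.Point.congrEquiv hX (.some _ _ hL), hbEm⟩ :
        ((W.localMinimalIntegralModel v).map ι).nonsingularReductionSubgroup hvw) = ⟨.some _ _ hL', hbE' hL'⟩ :=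
      Subtype.ext hcongr
    rw [h1, hr a₁ b₁ hL' hns_res (hbE' hL')]
    have h2 : (WeierstrassCurve.Affine.Point.some _ _ hns_res :
        (singularModel x₀ y₀ α α).toAffine.Point) = .some αQ βQ hnsQ :=
      point_some_eq_some ha₁ hb₁
    rw [h2, hQ]
  -- the moved point `φ b = (φ a₁, φ b₁)`: in `E₀`, with `r(φ b) = β^q`
  have hσns : (singularModel x₀ y₀ α α).toAffine.Nonsingular
      (IsLocalRing.residue w.integer (σR a₁)) (IsLocalRing.residue w.integer (σR b₁)) := by
    have h := singularModel.nonsingular_map σk hnsQ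
    rw [hx₀, hy₀, hα] at h
    rw [← hσk, ← hσk, ha₁, hb₁]
    exact h
  have hab' : ((W.localMinimalIntegralModel v).map ι).toAffine.Equation (σR a₁) (σR b₁) := by
    have h : (((W.localMinimalIntegralModel v).map ι).map σR).toAffine.Equation (σR a₁) (σR b₁) :=
      (Affine.Equation.map σR hab : _)
    rwa [hWσ] at h
  have hφL : (((W.localMinimalIntegralModel v).map (algebraMap (v.adicCompletionIntegers K) (v.adicCompletion K))).baseChange
      (AlgebraicClosure (v.adicCompletion K))).toAffine.Nonsingular
      ((σR a₁ : w.integer) : AlgebraicClosure (v.adicCompletion K)) ((σR b₁ : w.integer) : AlgebraicClosure (v.adicCompletion K)) := by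
    rw [← Affine.equation_iff_nonsingular, hX]
    exact (map_equation_iff hvw.hom_inj).mpr hab'
  have hφL' : (((W.localMinimalIntegralModel v).map ι).baseChange (AlgebraicClosure (v.adicCompletion K))).toAffine.Nonsingular
      (algebraMap w.integer (AlgebraicClosure (v.adicCompletion K)) (σR a₁))
      (algebraMap w.integer (AlgebraicClosure (v.adicCompletion K)) (σR b₁)) := by
    have h := hφL; rw [hX] at h; exact h
  have hφbE' : ∀ h', ((W.localMinimalIntegralModel v).map ι).HasNonsingularReduction
      (.some (algebraMap w.integer (AlgebraicClosure (v.adicCompletion K)) (σR a₁))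
        (algebraMap w.integer (AlgebraicClosure (v.adicCompletion K)) (σR b₁)) h') := fun h' ↦
    (hasNonsingularReduction_some_algebraMap_iff hvw.hom_inj h').mpr (by rw [hW]; exact hσns)
  have hmap : WeierstrassCurve.Affine.Point.map (W' := (W.localMinimalIntegralModel v).map (algebraMap (v.adicCompletionIntegers K) (v.adicCompletion K)))
      ((absoluteGaloisGroup.toAlgEquiv (v.adicCompletion K) φ :
        AlgebraicClosure (v.adicCompletion K) ≃ₐ[v.adicCompletion K] AlgebraicClosure (v.adicCompletion K)) :
        AlgebraicClosure (v.adicCompletion K) →ₐ[v.adicCompletion K] AlgebraicClosure (v.adicCompletion K)) (.some _ _ hL) =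
      .some _ _ hφL := by
    rw [Affine.Point.map_some]; rfl
  have hφcongr : Affine.Point.congrEquiv hX (.some _ _ hφL) = .some _ _ hφL' := by
    rw [Affine.Point.congrEquiv_some]; rfl
  have hφbE : ((W.localMinimalIntegralModel v).map ι).HasNonsingularReduction
      (Affine.Point.congrEquiv hX (WeierstrassCurve.Affine.Point.map (W' := (W.localMinimalIntegralModel v).map (algebraMap (v.adicCompletionIntegers K) (v.adicCompletion K)))
        ((absoluteGaloisGroup.toAlgEquiv (v.adicCompletion K) φ :
          AlgebraicClosure (v.adicCompletion K) ≃ₐ[v.adicCompletion K] AlgebraicClosure (v.adicCompletion K)) :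
          AlgebraicClosure (v.adicCompletion K) →ₐ[v.adicCompletion K] AlgebraicClosure (v.adicCompletion K)) (.some _ _ hL))) := by
    rw [hmap, hφcongr]; exact hφbE' _
  have hφbEm : Affine.Point.congrEquiv hX (WeierstrassCurve.Affine.Point.map (W' := (W.localMinimalIntegralModel v).map (algebraMap (v.adicCompletionIntegers K) (v.adicCompletion K)))
        ((absoluteGaloisGroup.toAlgEquiv (v.adicCompletion K) φ :
          AlgebraicClosure (v.adicCompletion K) ≃ₐ[v.adicCompletion K] AlgebraicClosure (v.adicCompletion K)) :
          AlgebraicClosure (v.adicCompletion K) →ₐ[v.adicCompletion K] AlgebraicClosure (v.adicCompletion K)) (.some _ _ hL)) ∈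
      ((W.localMinimalIntegralModel v).map ι).nonsingularReductionSubgroup hvw := hφbE
  have hrφb : r ⟨_, hφbEm⟩ = β ^ Nat.card (IsLocalRing.ResidueField (v.adicCompletionIntegers K)) := by
    have h1 : (⟨_, hφbEm⟩ : ((W.localMinimalIntegralModel v).map ι).nonsingularReductionSubgroup hvw) =
        ⟨.some _ _ hφL', hφbE' hφL'⟩ := Subtype.ext ((congrArg _ hmap).trans hφcongr)
    rw [h1, hr (σR a₁) (σR b₁) hφL' hσns (hφbE' hφL'), ← hσkq, ← hQ]
    have hns' : (singularModel (σk x₀) (σk y₀) (σk α) (σk α)).toAffine.Nonsingular (σk αQ) (σk βQ) :=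
      singularModel.nonsingular_map σk hnsQ
    rw [← cuspFun_map_some σk hnsQ hns']
    -- both sides are `cuspFun` of the same coordinates for the same parameters
    have e1 : IsLocalRing.residue w.integer (σR a₁) = σk αQ := by rw [← hσk, ha₁]
    have e2 : IsLocalRing.residue w.integer (σR b₁) = σk βQ := by rw [← hσk, hb₁]
    simp only [singularModel.cuspFun, e1, e2, hx₀, hy₀, hα]
  -- `b` is fixed by `I_𝔐`
  refine ⟨.some _ _ hL, fun τ hτ ↦ ?_, ?_⟩
  · rw [Affine.Point.map_some]
    exact point_some_eq_some (ha₁I τ hτ) (hb₁I τ hτ)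
  -- `r(m - (φ b - b)) = a - (β^q - β) = 0`
  have key : r (⟨_, hmE⟩ - (⟨_, hφbEm⟩ - ⟨_, hbEm⟩)) = 0 := by
    rw [map_sub, map_sub, hrφb, hrb, ← hβ, sub_self]
  have hred := (hr0 _).mp key
  rw [← hker]
  simpa only [AddSubgroupClass.coe_sub, map_sub] using hred

end Model

end Summit.BirchSwinnertonDyer.Rank1Residual.X11b.Three.UnramifiedNode

end
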